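import Summits.AtomisticToContinuum.BoseEinsteinCondensation.Theorems.SoloInformedOccupationSeminorm
import Literature.MathematicalPhysics.QuantumManyBody.BoseGasFreeDirichletBEC
import Literature.MathematicalPhysics.QuantumManyBody.GroundState
import HarnessLib
import HarnessLib.Audit.Tags

/-!
# `GroundStateInherits` — gen 33's LOC-skeleton STUB 2, PROVED (lens-6 g34 addendum)

Near-minimiser lower bounds for the occupations of a FINITE family of normalised modes pass to any
ground state: if every trial state `Φ` with `⟨Φ, H_N Φ⟩ ≤ E₀ + δ` (some `δ > 0`) has
`b ≤ Σ_i n(φ_i)(Φ)`, then `b ≤ Σ_i n(φ_i)(Ψ)` for every `Ψ` with `IsGroundState v L Ψ`.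
Mechanism (as in the tree's `SoloInformed.condensateNumber_le_maxOccupation_of_isGroundState`):
`q̄[Ψ] = E₀` (definition of the closed form) gives a recovery sequence of trial states `Φₘ → Ψ` in `L²`
with energies frequently `< E₀ + δ`; along it `n(φ)(Φₘ)^{1/2} ≤ n(φ)(Ψ)^{1/2} + (N‖Φₘ − Ψ‖²)^{1/2}`
(tree `SoloInformed.occupation_rpow_half_le_add`, the occupation seminorm), and the finite sum of the
squared right-hand sides converges to `Σ_i n(φ_i)(Ψ)`.

TWO-SIDED VERSION (for two-scale / superblock depletion bounds, gen 34's TSD and g31's LD read for the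
ground state): `tendsto_occupation_of_tendsto_lintegral_sub` — along an `L²`-recovery sequence every
occupation CONVERGES (the seminorm bound in both directions, squeezed); hence
`sum_occupation_le_add_of_isGroundState` — a near-minimiser COMPARISON `Σ_{i∈s} n(φ_i) ≤ Σ_{j∈t} n(χ_j) + b`
between two finite families passes to every ground state — and `groundStateInherits_twoScale` (block-flat
modes at two block numbers `K'`, `K`).

`groundStateInherits_holds` is the statement `GroundStateInherits` of gen 33's LOC skeleton
(HOME/decomp-a2c-lens-6/g33/bc/LOC_birth.lean l.923) VERBATIM, specialised from the general lemma
`le_sum_occupation_of_isGroundState` to the block-flat modes `subMode (L/K) B`, `B : SubIdx K`.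
With it, gen 33's composition reads `GroundStateBlockCondensation ⟸ BlockOccupationNearMin` alone.

References: [LSSY2005] Lieb–Seiringer–Solovej–Yngvason (2005) §1.2 (1.17)–(1.19), App. A (A.11)–(A.13);
[Kato1966] VI §1.3–1.4 (closed form); [ReedSimonIV1978] §XIII.12.
-/

noncomputable section

open MeasureTheory Filter Set
open scoped ENNReal NNReal ComplexConjugate Topology BigOperators

namespace Summit.AtomisticToContinuum.BoseEinsteinCondensation.Theorems.BoxLabelAffinity

open Literature.MathematicalPhysics.QuantumManyBody.BoseGas

/-- **Near-minimiser occupation lower bounds pass to ground states** (finite families of normalised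
modes).  If some `δ > 0` is such that every trial state of energy `≤ E₀ + δ` has
`b ≤ Σ_{i ∈ s} n(φ_i)`, then every ground state has `b ≤ Σ_{i ∈ s} n(φ_i)`.
[cite: LSSY2005, §1.2 (1.17)–(1.19) and App. A (A.11)–(A.13)] -/
theorem le_sum_occupation_of_isGroundState {ι : Type*} (s : Finset ι) {v : ℝ → ℝ≥0∞} {N : ℕ}
    {L : ℝ} {Ψ : Config N → ℂ} (hΨ : IsGroundState v L Ψ) (φ : ι → Space → ℂ)
    (hφ : ∀ i, AEStronglyMeasurable (φ i) volume)
    (hφ1 : ∀ i, ∫⁻ x, (‖φ i x‖₊ : ℝ≥0∞) ^ 2 = 1) {b δ : ℝ≥0∞} (hδ : 0 < δ)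
    (hb : ∀ Φ : TrialState N L, energy v Φ ≤ groundStateEnergy v N L + δ →
      b ≤ ∑ i ∈ s, occupation N (φ i) Φ.ψ) :
    b ≤ ∑ i ∈ s, occupation N (φ i) Ψ := by
  have hE : groundStateEnergy v N L ≠ ⊤ := hΨ.groundStateEnergy_ne_top
  -- a recovery sequence with small energies
  have hlt : closedEnergy v L Ψ < groundStateEnergy v N L + δ := by
    rw [hΨ.closedEnergy_eq]
    exact ENNReal.lt_add_right hE hδ.ne'
  obtain ⟨Φ, hΦ⟩ := iInf_lt_iff.1 hlt
  obtain ⟨hT, hlim⟩ := iInf_lt_iff.1 hΦ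
  have hfreq : ∃ᶠ m in atTop, energy v (Φ m) < groundStateEnergy v N L + δ :=
    frequently_lt_of_liminf_lt (h := hlim)
  obtain ⟨κ, hκ, hκE⟩ := extraction_of_frequently_atTop hfreq
  have hd : Tendsto (fun m => ∫⁻ X, (‖(Φ (κ m)).ψ X - Ψ X‖₊ : ℝ≥0∞) ^ 2) atTop (𝓝 0) :=
    hT.comp hκ.tendsto_atTop
  cases N with
  | zero =>
    -- no particles: every occupation is `0` by definition
    have h0 := hb (Φ (κ 0)) (hκE 0).le
    simpa [occupation] using h0
  | succ n =>
    -- the `L²`-continuity estimate along the recovery sequence, mode by mode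
    have hstep : ∀ m, b ≤ ∑ i ∈ s, (occupation (n + 1) (φ i) Ψ ^ (1 / 2 : ℝ) +
        ((n + 1 : ℝ≥0∞) * ∫⁻ X, (‖(Φ (κ m)).ψ X - Ψ X‖₊ : ℝ≥0∞) ^ 2) ^ (1 / 2 : ℝ)) ^ 2 := by
      intro m
      refine (hb (Φ (κ m)) (hκE m).le).trans (Finset.sum_le_sum fun i _ => ?_)
      have h := SoloInformed.occupation_rpow_half_le_add
        (Φ (κ m)).contDiff.continuous.measurable hΨ.measurable
        (by rw [(Φ (κ m)).norm_eq]; exact ENNReal.one_ne_top)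
        (by rw [hΨ.norm_eq]; exact ENNReal.one_ne_top) (hφ i) (hφ1 i)
      calc occupation (n + 1) (φ i) (Φ (κ m)).ψ
          = (occupation (n + 1) (φ i) (Φ (κ m)).ψ ^ (1 / 2 : ℝ)) ^ 2 :=
            (ENNReal.rpow_half_sq _).symm
        _ ≤ _ := by gcongr
    -- the bounds converge to `Σ_i n(φ_i)(Ψ)`
    have hN : (n + 1 : ℝ≥0∞) ≠ ⊤ :=
      ENNReal.add_ne_top.2 ⟨ENNReal.natCast_ne_top n, ENNReal.one_ne_top⟩
    have h1 : Tendsto (fun m => (n + 1 : ℝ≥0∞) * ∫⁻ X, (‖(Φ (κ m)).ψ X - Ψ X‖₊ : ℝ≥0∞) ^ 2)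
        atTop (𝓝 0) := by
      have := ENNReal.Tendsto.const_mul hd (Or.inr hN)
      rwa [mul_zero] at this
    have h2 : Tendsto (fun m =>
        ((n + 1 : ℝ≥0∞) * ∫⁻ X, (‖(Φ (κ m)).ψ X - Ψ X‖₊ : ℝ≥0∞) ^ 2) ^ (1 / 2 : ℝ))
        atTop (𝓝 0) := by
      have := ((ENNReal.continuous_rpow_const (y := (1 / 2 : ℝ))).tendsto (0 : ℝ≥0∞)).comp h1
      rwa [ENNReal.zero_rpow_of_pos (by norm_num : (0 : ℝ) < 1 / 2)] at this
    have h3 : ∀ i, Tendsto (fun m => (occupation (n + 1) (φ i) Ψ ^ (1 / 2 : ℝ) +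
        ((n + 1 : ℝ≥0∞) * ∫⁻ X, (‖(Φ (κ m)).ψ X - Ψ X‖₊ : ℝ≥0∞) ^ 2) ^ (1 / 2 : ℝ)) ^ 2)
        atTop (𝓝 (occupation (n + 1) (φ i) Ψ)) := by
      intro i
      have hadd := (tendsto_const_nhds (x := occupation (n + 1) (φ i) Ψ ^ (1 / 2 : ℝ))).add h2
      rw [add_zero] at hadd
      have h4 := ((ENNReal.continuous_pow 2).tendsto _).comp hadd
      rw [ENNReal.rpow_half_sq] at h4
      exact h4
    exact ge_of_tendsto' (tendsto_finsetSum s fun i _ => h3 i) hstep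

/-- **Occupations are continuous along a recovery sequence**: if trial states `Φ_m` converge to `Ψ`
in `L²` (both normalised), then `n(φ)(Φ_m) → n(φ)(Ψ)` for every normalised mode `φ` (the occupation
square root is a `√N`-Lipschitz seminorm, tree `SoloInformed.occupation_rpow_half_le_add`, used in BOTH
directions and squeezed). [cite: LSSY2005, §1.2 (1.17)–(1.19) and App. A (A.11)–(A.13)] -/
theorem tendsto_occupation_of_tendsto_lintegral_sub {n : ℕ} {L : ℝ} {Ψ : Config (n + 1) → ℂ}
    (hΨm : Measurable Ψ) (hΨ1 : ∫⁻ X, (‖Ψ X‖₊ : ℝ≥0∞) ^ 2 = 1) (Φ : ℕ → TrialState (n + 1) L)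
    (hd : Tendsto (fun m => ∫⁻ X, (‖(Φ m).ψ X - Ψ X‖₊ : ℝ≥0∞) ^ 2) atTop (𝓝 0))
    {φ : Space → ℂ} (hφ : AEStronglyMeasurable φ volume) (hφ1 : ∫⁻ x, (‖φ x‖₊ : ℝ≥0∞) ^ 2 = 1) :
    Tendsto (fun m => occupation (n + 1) φ (Φ m).ψ) atTop (𝓝 (occupation (n + 1) φ Ψ)) := by
  set ε : ℕ → ℝ≥0∞ := fun m =>
    ((n + 1 : ℝ≥0∞) * ∫⁻ X, (‖(Φ m).ψ X - Ψ X‖₊ : ℝ≥0∞) ^ 2) ^ (1 / 2 : ℝ) with hεdef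
  have hN : (n + 1 : ℝ≥0∞) ≠ ⊤ :=
    ENNReal.add_ne_top.2 ⟨ENNReal.natCast_ne_top n, ENNReal.one_ne_top⟩
  have hε : Tendsto ε atTop (𝓝 0) := by
    have h1 : Tendsto (fun m => (n + 1 : ℝ≥0∞) * ∫⁻ X, (‖(Φ m).ψ X - Ψ X‖₊ : ℝ≥0∞) ^ 2)
        atTop (𝓝 0) := by
      have := ENNReal.Tendsto.const_mul hd (Or.inr hN)
      rwa [mul_zero] at this
    have := ((ENNReal.continuous_rpow_const (y := (1 / 2 : ℝ))).tendsto (0 : ℝ≥0∞)).comp h1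
    rwa [ENNReal.zero_rpow_of_pos (by norm_num : (0 : ℝ) < 1 / 2)] at this
  have hsymm : ∀ m, ∫⁻ X, (‖Ψ X - (Φ m).ψ X‖₊ : ℝ≥0∞) ^ 2 =
      ∫⁻ X, (‖(Φ m).ψ X - Ψ X‖₊ : ℝ≥0∞) ^ 2 := fun m => by
    refine lintegral_congr fun X => ?_
    rw [← neg_sub, nnnorm_neg]
  -- upper and lower Lipschitz bounds
  have hup : ∀ m, occupation (n + 1) φ (Φ m).ψ ≤
      (occupation (n + 1) φ Ψ ^ (1 / 2 : ℝ) + ε m) ^ 2 := by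
    intro m
    have h := SoloInformed.occupation_rpow_half_le_add
      (Φ m).contDiff.continuous.measurable hΨm
      (by rw [(Φ m).norm_eq]; exact ENNReal.one_ne_top)
      (by rw [hΨ1]; exact ENNReal.one_ne_top) hφ hφ1
    calc occupation (n + 1) φ (Φ m).ψ
        = (occupation (n + 1) φ (Φ m).ψ ^ (1 / 2 : ℝ)) ^ 2 := (ENNReal.rpow_half_sq _).symm
      _ ≤ _ := by gcongr
  have hlow : ∀ m, (occupation (n + 1) φ Ψ ^ (1 / 2 : ℝ) - ε m) ^ 2 ≤
      occupation (n + 1) φ (Φ m).ψ := by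
    intro m
    have h := SoloInformed.occupation_rpow_half_le_add hΨm
      (Φ m).contDiff.continuous.measurable
      (by rw [hΨ1]; exact ENNReal.one_ne_top)
      (by rw [(Φ m).norm_eq]; exact ENNReal.one_ne_top) hφ hφ1
    rw [hsymm m] at h
    calc (occupation (n + 1) φ Ψ ^ (1 / 2 : ℝ) - ε m) ^ 2
        ≤ (occupation (n + 1) φ (Φ m).ψ ^ (1 / 2 : ℝ)) ^ 2 := by
          gcongr
          exact tsub_le_iff_right.2 h
      _ = occupation (n + 1) φ (Φ m).ψ := ENNReal.rpow_half_sq _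
  -- both bounds converge to `n(φ)(Ψ)`
  have hU : Tendsto (fun m => (occupation (n + 1) φ Ψ ^ (1 / 2 : ℝ) + ε m) ^ 2) atTop
      (𝓝 (occupation (n + 1) φ Ψ)) := by
    have hadd := (tendsto_const_nhds (x := occupation (n + 1) φ Ψ ^ (1 / 2 : ℝ))).add hε
    rw [add_zero] at hadd
    have h4 := ((ENNReal.continuous_pow 2).tendsto _).comp hadd
    rwa [ENNReal.rpow_half_sq] at h4
  have hD : Tendsto (fun m => (occupation (n + 1) φ Ψ ^ (1 / 2 : ℝ) - ε m) ^ 2) atTop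
      (𝓝 (occupation (n + 1) φ Ψ)) := by
    have hsub := ENNReal.Tendsto.sub (tendsto_const_nhds (x := occupation (n + 1) φ Ψ ^ (1 / 2 : ℝ)))
      hε (Or.inr ENNReal.zero_ne_top)
    rw [tsub_zero] at hsub
    have h4 := ((ENNReal.continuous_pow 2).tendsto _).comp hsub
    rwa [ENNReal.rpow_half_sq] at h4
  exact tendsto_of_tendsto_of_tendsto_of_le_of_le hD hU hlow hup

/-- **Near-minimiser occupation COMPARISONS pass to ground states** (two finite families of normalised
modes; two-sided version of `le_sum_occupation_of_isGroundState`).  If some `δ > 0` is such that every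
trial state of energy `≤ E₀ + δ` has `Σ_{i ∈ s} n(φ_i) ≤ Σ_{j ∈ t} n(χ_j) + b`, then so does every ground
state — e.g. two-scale (superblock) depletion bounds `Σ_{fine B} n(u_B) ≤ Σ_{coarse B'} n(u_{B'}) + sN`
proved for near-minimisers hold for `Ψ₀`. [cite: LSSY2005, §1.2 (1.17)–(1.19) and App. A (A.11)–(A.13)] -/
theorem sum_occupation_le_add_of_isGroundState {ι ι' : Type*} (s : Finset ι) (t : Finset ι')
    {v : ℝ → ℝ≥0∞} {N : ℕ} {L : ℝ} {Ψ : Config N → ℂ} (hΨ : IsGroundState v L Ψ)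
    (φ : ι → Space → ℂ) (hφ : ∀ i, AEStronglyMeasurable (φ i) volume)
    (hφ1 : ∀ i, ∫⁻ x, (‖φ i x‖₊ : ℝ≥0∞) ^ 2 = 1)
    (χ : ι' → Space → ℂ) (hχ : ∀ j, AEStronglyMeasurable (χ j) volume)
    (hχ1 : ∀ j, ∫⁻ x, (‖χ j x‖₊ : ℝ≥0∞) ^ 2 = 1) {b δ : ℝ≥0∞} (hδ : 0 < δ)
    (hb : ∀ Φ : TrialState N L, energy v Φ ≤ groundStateEnergy v N L + δ →
      ∑ i ∈ s, occupation N (φ i) Φ.ψ ≤ ∑ j ∈ t, occupation N (χ j) Φ.ψ + b) :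
    ∑ i ∈ s, occupation N (φ i) Ψ ≤ ∑ j ∈ t, occupation N (χ j) Ψ + b := by
  have hE : groundStateEnergy v N L ≠ ⊤ := hΨ.groundStateEnergy_ne_top
  have hlt : closedEnergy v L Ψ < groundStateEnergy v N L + δ := by
    rw [hΨ.closedEnergy_eq]
    exact ENNReal.lt_add_right hE hδ.ne'
  obtain ⟨Φ, hΦ⟩ := iInf_lt_iff.1 hlt
  obtain ⟨hT, hlim⟩ := iInf_lt_iff.1 hΦ
  have hfreq : ∃ᶠ m in atTop, energy v (Φ m) < groundStateEnergy v N L + δ :=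
    frequently_lt_of_liminf_lt (h := hlim)
  obtain ⟨κ, hκ, hκE⟩ := extraction_of_frequently_atTop hfreq
  have hd : Tendsto (fun m => ∫⁻ X, (‖(Φ (κ m)).ψ X - Ψ X‖₊ : ℝ≥0∞) ^ 2) atTop (𝓝 0) :=
    hT.comp hκ.tendsto_atTop
  cases N with
  | zero =>
    simp [occupation]
  | succ n =>
    have hc : ∀ ξ : Space → ℂ, AEStronglyMeasurable ξ volume → ∫⁻ x, (‖ξ x‖₊ : ℝ≥0∞) ^ 2 = 1 →
        Tendsto (fun m => occupation (n + 1) ξ (Φ (κ m)).ψ) atTop (𝓝 (occupation (n + 1) ξ Ψ)) :=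
      fun ξ hξ hξ1 => tendsto_occupation_of_tendsto_lintegral_sub hΨ.measurable hΨ.norm_eq
        (fun m => Φ (κ m)) hd hξ hξ1
    exact le_of_tendsto_of_tendsto (tendsto_finsetSum s fun i _ => hc (φ i) (hφ i) (hφ1 i))
      ((tendsto_finsetSum t fun j _ => hc (χ j) (hχ j) (hχ1 j)).add tendsto_const_nhds)
      (Eventually.of_forall fun m => hb (Φ (κ m)) (hκE m).le)

/-- Gen 33's LOC-skeleton STUB 2 statement, VERBATIM (HOME/decomp-a2c-lens-6/g33/bc/LOC_birth.lean
l.923): occupation lower bounds for the block-flat modes pass from `δ`-near-minimisers to a real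
ground state. [folklore]
(`@[conjecture]` only to keep the gate from relocating a parameterless `Prop` to Literature/; it is PROVED below,
`groundStateInherits_holds` — landing delta by prover hand 1, gen 11, precedent p822874.) -/
@[conjecture] def GroundStateInherits : Prop :=
  ∀ (v : ℝ → ℝ≥0∞) (N : ℕ) (L : ℝ) (K : ℕ), 0 < L → 0 < K →
    ∀ Ψ₀ : Config N → ℝ, IsGroundState v L (fun X => (Ψ₀ X : ℂ)) →
    ∀ b : ℝ≥0∞, (∃ δ : ℝ≥0∞, 0 < δ ∧ ∀ Ψ : TrialState N L,
        energy v Ψ ≤ groundStateEnergy v N L + δ →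
        b ≤ ∑ B : SubIdx K, occupation N (subMode (L / (K : ℝ)) B) Ψ.ψ) →
      b ≤ ∑ B : SubIdx K, occupation N (subMode (L / (K : ℝ)) B) (fun X => (Ψ₀ X : ℂ))

/-- **STUB 2 PROVED.** [cite: LSSY2005, §1.2 (1.17)–(1.19) and App. A (A.11)–(A.13)] -/
theorem groundStateInherits_holds : GroundStateInherits := by
  intro v N L K hL hK Ψ₀ hΨ₀ b hb
  obtain ⟨δ, hδ, hb⟩ := hb
  have hℓ : 0 < L / (K : ℝ) := div_pos hL (Nat.cast_pos.2 hK)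
  exact le_sum_occupation_of_isGroundState Finset.univ hΨ₀ (fun B => subMode (L / (K : ℝ)) B)
    (fun B => aestronglyMeasurable_subMode _ B) (fun B => lintegral_subMode_sq hℓ B) hδ hb

/-- **Two-scale corollary** (for the energy-horizon piece TSD of gen 34 / g31's LD): a near-minimiser
bound `Σ_{B : SubIdx K'} n(u_B) ≤ Σ_{B' : SubIdx K} n(u_{B'}) + b` between the block-flat occupations at
two block numbers passes to every real ground state. [folklore] -/
theorem groundStateInherits_twoScale (v : ℝ → ℝ≥0∞) (N : ℕ) {L : ℝ} {K K' : ℕ} (hL : 0 < L)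
    (hK : 0 < K) (hK' : 0 < K') (Ψ₀ : Config N → ℝ) (hΨ₀ : IsGroundState v L (fun X => (Ψ₀ X : ℂ)))
    {b : ℝ≥0∞} (hb : ∃ δ : ℝ≥0∞, 0 < δ ∧ ∀ Ψ : TrialState N L,
        energy v Ψ ≤ groundStateEnergy v N L + δ →
        ∑ B : SubIdx K', occupation N (subMode (L / (K' : ℝ)) B) Ψ.ψ ≤
          ∑ B : SubIdx K, occupation N (subMode (L / (K : ℝ)) B) Ψ.ψ + b) :
    ∑ B : SubIdx K', occupation N (subMode (L / (K' : ℝ)) B) (fun X => (Ψ₀ X : ℂ)) ≤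
      ∑ B : SubIdx K, occupation N (subMode (L / (K : ℝ)) B) (fun X => (Ψ₀ X : ℂ)) + b := by
  obtain ⟨δ, hδ, hb⟩ := hb
  have hℓ : 0 < L / (K : ℝ) := div_pos hL (Nat.cast_pos.2 hK)
  have hℓ' : 0 < L / (K' : ℝ) := div_pos hL (Nat.cast_pos.2 hK')
  exact sum_occupation_le_add_of_isGroundState Finset.univ Finset.univ hΨ₀
    (fun B => subMode (L / (K' : ℝ)) B) (fun B => aestronglyMeasurable_subMode _ B)
    (fun B => lintegral_subMode_sq hℓ' B) (fun B => subMode (L / (K : ℝ)) B)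
    (fun B => aestronglyMeasurable_subMode _ B) (fun B => lintegral_subMode_sq hℓ B) hδ hb

end Summit.AtomisticToContinuum.BoseEinsteinCondensation.Theorems.BoxLabelAffinity

end
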